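import Summits.CriticalPhenomena.PercolationContinuityZ3.Theorems.PercAnnulusCrossingIICManyPointsTreeUpper
import HarnessLib

/-!
# The k-point function of Kesten's IIC is the minimal spanning tree: the two-sided formula (lane RSW3, p1 gen 21)

builds on p205010 (kernel theorem, internal audit signed; external expert review pending) — USED through `θ(p_c) = 0` (exact re-rooting).

RSW3 lane (LANE 3 `prim-rsw3`), seat `prim-rsw3-p1` (gen 21).  Helper file (`--supports stmt-CriticalPhenomena-4575`);
no definitions, no sorries.  Memo `run/shared/lean/prim/rsw3/P1-QM.md` §34.8.

The two halves `…IICManyPointsTreeLower` (separation `2l² + l`) and `…IICManyPointsTreeUpper` (separation `4ls`) under ONE separation constant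
`4l²s` (`≥` both):

* **`exists_iicMeasure_real_biInter_openConn_two_sided_tree_criticalProbI`** — at `p_c(ℤ^d)`, `d ≥ 2`, under (A2)□(s,L) + `CU⁺_l` + UAD: there are
  `n₀ ≥ 1` and `0 < c, C` such that for every IIC probability measure `ν`, every `k`, sites `z_0 = 0, z_1, …, z_k` and parents `p(i) < i` with
  `‖z_i − z_{p(i)}‖ ≥ n₀` and `z_j − z_{p(i)} ∉ Λ(4l²s·‖z_i − z_{p(i)}‖)` (`j < i`, `j ≠ p(i)`):
  **`c^k ∏_{i=1}^{k} π_{p_c}(‖z_i − z_{p(i)}‖) ≤ ν(z_1, …, z_k ∈ C(0)) ≤ C^k ∏_{i=1}^{k} π_{p_c}(‖z_i − z_{p(i)}‖)`** — for sites inserted top-down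
  along a `4l²s`-separated single-linkage dendrogram of `{0} ∪ S` the `‖z_i − z_{p(i)}‖` are the edge lengths of the minimal spanning tree, so
  **`ν(S ⊆ C(0)) ≍ ∏_{e ∈ MST({0} ∪ S)} π_{p_c}(|e|)`** up to `c^k, C^k`.
References: H. Kesten, Probab. Theory Relat. Fields 73 (1986) Thm. (8); D. Basu, A. Sapozhnikov, ECP 22 (2017) Thm. 1.1, Remark 2.1.
-/

noncomputable section

namespace Summit.CriticalPhenomena.PercolationContinuityZ3.Theorems.Crossing

open MeasureTheory Filter Topology Literature.Probability.Percolation Literature.Probability.LatticeModels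
open Literature.Probability.Percolation.DCT16
open Summit.CriticalPhenomena.PercolationContinuityZ3.Theorems.SurfaceTension

variable {d : ℕ}

open Classical in
/-- **THE k-POINT FUNCTION OF KESTEN'S IIC IS THE MINIMAL SPANNING TREE** (`p_c(ℤ^d)`, `d ≥ 2`; (A2)□ at aspect `(s,L)`, `2 ≤ s ≤ L`, `ϰ > 0`;
`CU⁺_l(c_U)`, `l ≥ 2`, `c_U > 0`; UAD): there are `n₀ ≥ 1` and `0 < c, C` such that for every IIC probability measure `ν`, every `k`, all sites
`z_0 = 0, z_1, …, z_k` and parents `p(i) < i` (`1 ≤ i ≤ k`) with `‖z_i − z_{p(i)}‖_∞ ≥ n₀` and `z_j − z_{p(i)} ∉ Λ(4l²s·‖z_i − z_{p(i)}‖_∞)` for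
`j < i`, `j ≠ p(i)`: **`c^k ∏_{i=1}^{k} π_{p_c}(‖z_i − z_{p(i)}‖) ≤ ν(⋂_{i=1}^{k}{0 ↔ z_i}) ≤ C^k ∏_{i=1}^{k} π_{p_c}(‖z_i − z_{p(i)}‖)`**.
[cite: Kesten1986, Thm. (8)] [cite: BasuSapozhnikov2017ECP, Thm. 1.1 and Remark 2.1] -/
theorem exists_iicMeasure_real_biInter_openConn_two_sided_tree_criticalProbI (hd : 2 ≤ d) {s L : ℕ} (hs : 2 ≤ s) (hsL : s ≤ L)
    {ϰ : ℝ} (hϰ : 0 < ϰ) (hA2 : SetToSetQuasiMultAspectAt d (criticalProbI d) s L ϰ) {l : ℕ} (hl : 2 ≤ l) {cU : ℝ} (hcU : 0 < cU)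
    (hCU : ∀ a : ℕ, 1 ≤ a → ∀ E : Set (BondConfig (Site d)), IsUpperSet E → MeasurableSet E →
      cU * (bondPercolation (zdGraph d) (criticalProbI d)).real E ≤ (bondPercolation (zdGraph d) (criticalProbI d)).real (E ∩
        {ω : BondConfig (Site d) | ∀ t ∈ innerBoundary (zdGraph d) (box d a), ∀ s ∈ innerBoundary (zdGraph d) (box d (l * a)),
          ∀ t' ∈ innerBoundary (zdGraph d) (box d a), ∀ s' ∈ innerBoundary (zdGraph d) (box d (l * a)),
          ω ∈ openConnIn (↑((box d (l * a) \ box d a) ∪ innerBoundary (zdGraph d) (box d a)) : Set (Site d)) t s →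
          ω ∈ openConnIn (↑((box d (l * a) \ box d a) ∪ innerBoundary (zdGraph d) (box d a)) : Set (Site d)) t' s' →
          ω ∈ openConnIn (↑((box d (l * a) \ box d a) ∪ innerBoundary (zdGraph d) (box d a)) : Set (Site d)) s s'}))
    (hUAD : ∀ ε : ℝ, 0 < ε → ∃ K₀ : ℕ, ∀ m : ℕ, 1 ≤ m → ∀ N : ℕ, K₀ * m ≤ N →
      (bondPercolation (zdGraph d) (criticalProbI d)).real (boxCrossing d m N) ≤ ε) :
    ∃ (n₀ : ℕ) (c C : ℝ), 1 ≤ n₀ ∧ 0 < c ∧ 0 < C ∧ ∀ (ν : Measure (BondConfig (Site d))) [IsProbabilityMeasure ν],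
      (∀ (F : Finset (Sym2 (Site d))) (E : Set (BondConfig (Site d))), MeasurableSet E → DeterminedBy E ↑F →
        Tendsto (fun n : ℕ => (bondPercolation (zdGraph d) (criticalProbI d)).real (E ∩ siteToBoundary d n) /
          oneArmProb d (criticalProbI d) n) atTop (𝓝 (ν.real E))) →
      ∀ (k : ℕ) (z : ℕ → Site d) (par : ℕ → ℕ), z 0 = 0 → (∀ i, 1 ≤ i → i ≤ k → par i < i) →
        (∀ i, 1 ≤ i → i ≤ k → n₀ ≤ Site.supNorm (z i - z (par i))) →
        (∀ i, 1 ≤ i → i ≤ k → ∀ j, j < i → j ≠ par i → z j - z (par i) ∉ box d (4 * l ^ 2 * s * Site.supNorm (z i - z (par i)))) →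
          c ^ k * ∏ i ∈ Finset.Icc 1 k, oneArmProb d (criticalProbI d) (Site.supNorm (z i - z (par i))) ≤
              ν.real (⋂ i ∈ Finset.Icc 1 k, (openConn (0 : Site d) (z i) : Set (BondConfig (Site d)))) ∧
            ν.real (⋂ i ∈ Finset.Icc 1 k, (openConn (0 : Site d) (z i) : Set (BondConfig (Site d)))) ≤
              C ^ k * ∏ i ∈ Finset.Icc 1 k, oneArmProb d (criticalProbI d) (Site.supNorm (z i - z (par i))) := by
  obtain ⟨n₁, c, hn₁, hc, hlow⟩ := exists_iicMeasure_real_biInter_openConn_ge_pow_mul_prod_criticalProbI hd hs hsL hϰ hA2 hl hcU hCU hUAD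
  obtain ⟨n₂, C, hn₂, hC, hup⟩ := exists_iicMeasure_real_biInter_openConn_le_pow_mul_prod_criticalProbI hd hs hsL hϰ hA2 hl hcU hCU hUAD
  have h1 : 2 * l ^ 2 + l ≤ 4 * l ^ 2 * s := by nlinarith
  have h2 : 4 * l * s ≤ 4 * l ^ 2 * s := by nlinarith
  refine ⟨max n₁ n₂, c, C, le_trans hn₁ (le_max_left _ _), hc, hC, fun ν _ hν k z par hz0 hpar hfar hsep => ⟨?_, ?_⟩⟩
  · exact hlow ν hν k z par hz0 hpar (fun i hi1 hi2 => le_trans (le_max_left _ _) (hfar i hi1 hi2))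
      (fun i hi1 hi2 j hj hjp h => hsep i hi1 hi2 j hj hjp (box_mono d (Nat.mul_le_mul_right _ h1) h))
  · exact hup ν hν k z par hz0 hpar (fun i hi1 hi2 => le_trans (le_max_right _ _) (hfar i hi1 hi2))
      (fun i hi1 hi2 j hj hjp h => hsep i hi1 hi2 j hj hjp (box_mono d (Nat.mul_le_mul_right _ h2) h))

end Summit.CriticalPhenomena.PercolationContinuityZ3.Theorems.Crossing

end
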